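import Literature.NumberTheory.Transcendental.BrownMotivicOrbitPoint
import Literature.NumberTheory.Transcendental.IharaDerivationAlgebra
import Mathlib.Combinatorics.Enumerative.Composition
import HarnessLib

/-!
# The orbit map of the unit path from free Lie generators (Brown §2.5; [DG05, 5.8–5.12])

`BrownMotivicOrbitPoint.lean` reduced Brown's motivic package `MotivicMZV` to the Deligne–Goncharov
input stated at points (`motivicMZV_nonempty_of_pointOrbit`): (1) a graded shuffle character
`ρ : 𝒪(₀Π₁) → 𝒰' = ℚ⟨f₃, f₅, …⟩` whose orbit map `g ↦ g ∘ ρ = g·₀1₁` is a homomorphism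
`G_𝒰(B) → (₀Π₁(B), ⋆)` for Ihara's law `⋆` and every commutative `ℚ`-algebra `B`; (2) an even
rational point `γ` and a real point `(a, t₀)` of `G_𝒰 × 𝔸¹` with `dch = (a ∘ ρ) ⋆ τ(√t₀).γ`.

This file PROVES that clause (1) is automatic: by [Brown2012, §2.5] "`Lie G_𝒰` is isomorphic to
the free Lie algebra with one generator `σ_{2i+1}` in every degree `-2i-1`" ([DG05, Prop. 2.3]),
so that `𝒰' = 𝒪(G_𝒰)` is the shuffle algebra on letters `f_{2i+1}` with deconcatenation
([Brown2012, (2.20)]), and a graded homomorphism `G_𝒰 → (₀Π₁, ∘)` is the same as the choice of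
the images `σ_{2i+1} ∈ Lie(₀Π₁, ∘)` of the free generators, i.e. of homogeneous Lie (=
primitive) polynomials `σ_{2i+1} ∈ ℚ⟨e₀, e₁⟩` of weight `2i+1` acting by the infinitesimal Ihara
action `s_σ(x) = x σ + D_σ(x)` ([DG05, (5.11.4)–(5.12.1)], `IharaDerivationAlgebra.lean`).  For
ANY such family `σ` we construct (`ρgen σ`) the orbit map

  `ρ_σ(w) = Σ_W P_W(w) · f_W ∈ 𝒰'`,  `P_{aW} = s_{σ_a}(P_W)`, `P_∅ = 1`

(the matrix coefficients of the action of the enveloping algebra `ℚ⟨F₃, F₅, …⟩ = U(Lie G_𝒰)` on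
the unit path), and prove:

* `ρgen_nil`, `ρgen_mem` — `ρ_σ(∅) = 1`, `ρ_σ(w) ∈ 𝒰'_{|w|}` (graded);
* `ρgen_mul` — `ρ_σ` is a shuffle character `𝒪(₀Π₁) → 𝒰'` (from `delta_PW`: `W ↦ P_W` is a
  coalgebra map, the `σ_a` being primitive);
* `ρgen_pointHom` — **the orbit map is a homomorphism for Ihara's law at all points**:
  `(g*h) ∘ ρ_σ = (g ∘ ρ_σ) ⋆ (h ∘ ρ_σ)`, through the key identity (`pairS_eq_iharaWord_mul`)
  `Σ_W g(f_W) s_W(X_c) = ⟨a_g⟩(X_c) · a_g`, `a_g = g ∘ ρ_σ`: the exponential of the infinitesimal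
  action of a point `g` of the free group IS Ihara's action of its orbit point ([DG05, Prop. 5.11
  (5.11.5), 5.12]: `g·x = (g·₀1₁) ∘ x`);
* `motivicMZV_nonempty_of_lieGenerators` — hence Brown's package (and Hoffman's theorem, and
  `dim 𝒵_N ≤ d_N`) from: homogeneous primitive `σ_{2n+1}`, an even rational `γ`, a real point
  `(a, t₀)`, and `dch = (a ∘ ρ_σ) ⋆ τ(√t₀).γ` — the residual Deligne–Goncharov input as
  first-order data ([Brown2012, §2.3 (2.12), §2.5]; [DG05, 5.19–5.25]).

No named fact is introduced; the only definitions are the finite index sets of generator words,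
the orbit map `ρgen σ`, and the pairing `pairG` of a point with a family of polynomials.

## References

* F. Brown, *Mixed Tate motives over ℤ*, Ann. of Math. 175 (2012), §2.1 (2.4)–(2.6), §2.3
  (2.12), §2.5 (2.20)–(2.22); arXiv:1102.1312. [Brown2012]
* P. Deligne, A. B. Goncharov, *Groupes fondamentaux motiviques de Tate mixte*, Ann. Sci. ÉNS 38
  (2005), Prop. 2.3, 5.8–5.12, 5.19–5.25; arXiv:math/0302267. [DeligneGoncharov2005]
-/

noncomputable section

open scoped BigOperators

namespace Literature.NumberTheory.Transcendental

namespace Brown2012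

open MZV ShuffleMonoidAlgebra
open GoncharovFormalIteratedIntegrals (WordSeries wordX wordX_nil wordX_cons wordX_apply wordX_append
  contr contr_apply contr_mul_const iharaMul iharaWord conjWord_nil conjWord_cons
  conjWord_apply_ne_zero list_sum_map_finset_sum SW DW PW sI SW_nil SW_cons PW_nil PW_cons SW_append
  SW_mul DW_mul SW_X_true DW_one_of_ne_nil DW_X_false_of_ne_nil IsWt isWt_PW isWt_wordX
  PW_eq_zero_of_mem isLocal_SW delta_PW eq_of_X_apply_ne_zero)
open GoncharovFormalIteratedIntegrals renaming phi → phiK, phi_apply → phiK_apply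
open GoncharovFormalIteratedIntegrals.WordSeries (X C delta tensor delta_apply tensor_apply desh
  count_desh' list_map_sum_eq_sum_count)

/-! ## Words of generators: compositions -/

section Comp

/-- The words of positive integers of total weight `n` (compositions of `n`): the monomials
`F_W`, `|W| = n`, of the free algebra on generators of positive weights. [folklore] -/
def compSet (n : ℕ) : Finset (List ℕ) :=
  (Finset.univ : Finset (Composition n)).image Composition.blocks

/-- Membership in `compSet`. [folklore] -/
theorem mem_compSet {n : ℕ} {W : List ℕ} : W ∈ compSet n ↔ (∀ a ∈ W, 0 < a) ∧ W.sum = n := by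
  constructor
  · intro h
    obtain ⟨c, -, rfl⟩ := Finset.mem_image.1 h
    exact ⟨fun a ha => c.blocks_pos ha, c.blocks_sum⟩
  · rintro ⟨h1, h2⟩
    exact Finset.mem_image.2 ⟨⟨W, fun {a} ha => h1 a ha, h2⟩, Finset.mem_univ _, rfl⟩

/-- The words of positive integers of total weight `≤ m`. [folklore] -/
def compLe (m : ℕ) : Finset (List ℕ) := (Finset.range (m + 1)).biUnion compSet

/-- Membership in `compLe`. [folklore] -/
theorem mem_compLe {m : ℕ} {W : List ℕ} : W ∈ compLe m ↔ (∀ a ∈ W, 0 < a) ∧ W.sum ≤ m := by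
  simp only [compLe, Finset.mem_biUnion, Finset.mem_range, mem_compSet]
  constructor
  · rintro ⟨n, hn, h1, h2⟩
    exact ⟨h1, by omega⟩
  · rintro ⟨h1, h2⟩
    exact ⟨W.sum, by omega, h1, rfl⟩

/-- `∅ ∈ compLe m`. [folklore] -/
theorem nil_mem_compLe (m : ℕ) : ([] : List ℕ) ∈ compLe m :=
  mem_compLe.2 ⟨fun _ h => absurd h List.not_mem_nil, by simp⟩

/-- `compLe` is monotone. [folklore] -/
theorem compLe_mono {m m' : ℕ} (h : m ≤ m') : compLe m ⊆ compLe m' := fun W hW => by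
  rw [mem_compLe] at hW ⊢
  exact ⟨hW.1, hW.2.trans h⟩

/-- `compLe 0 = {∅}`. [folklore] -/
theorem compLe_zero : compLe 0 = {[]} := by
  ext W
  rw [mem_compLe, Finset.mem_singleton]
  constructor
  · rintro ⟨h1, h2⟩
    cases W with
    | nil => rfl
    | cons a W =>
      have := h1 a List.mem_cons_self
      rw [List.sum_cons] at h2
      omega
  · rintro rfl
    exact ⟨fun _ h => absurd h List.not_mem_nil, by simp⟩

/-- The pairs of words of positive integers of total weight `≤ m`. [folklore] -/
def compPairs (m : ℕ) : Finset (List ℕ × List ℕ) :=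
  (compLe m ×ˢ compLe m).filter fun p => p.1.sum + p.2.sum ≤ m

/-- Membership in `compPairs`. [folklore] -/
theorem mem_compPairs {m : ℕ} {p : List ℕ × List ℕ} :
    p ∈ compPairs m ↔ ((∀ a ∈ p.1, 0 < a) ∧ ∀ a ∈ p.2, 0 < a) ∧ p.1.sum + p.2.sum ≤ m := by
  simp only [compPairs, Finset.mem_filter, Finset.mem_product, mem_compLe]
  constructor
  · rintro ⟨⟨⟨h1, -⟩, h2, -⟩, h3⟩
    exact ⟨⟨h1, h2⟩, h3⟩
  · rintro ⟨⟨h1, h2⟩, h3⟩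
    exact ⟨⟨⟨h1, by omega⟩, h2, by omega⟩, h3⟩

/-- A deshuffle of `W` shuffles back to `W`. [folklore] -/
theorem mem_shuffleWord_of_mem_desh {W : List ℕ} {de : List ℕ × List ℕ} (h : de ∈ desh W) :
    W ∈ shuffleWord de.1 de.2 := by
  have h1 : 0 < (desh W : Multiset (List ℕ × List ℕ)).count de :=
    Multiset.count_pos.2 (Multiset.mem_coe.2 h)
  rw [count_desh'] at h1
  exact Multiset.mem_coe.1 (Multiset.count_pos.1 h1)

/-- Letters of a shuffle are letters of the factors, and conversely. [folklore] -/
theorem mem_iff_of_mem_shuffleWord {U V W : List ℕ} (h : W ∈ shuffleWord U V) (a : ℕ) :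
    a ∈ W ↔ a ∈ U ∨ a ∈ V := by
  rw [(perm_append_of_mem_shuffleWord U V h).mem_iff, List.mem_append]

/-- Deshuffles of a word in `compLe m` lie in `compPairs m`. [folklore] -/
theorem mem_compPairs_of_mem_desh {m : ℕ} {W : List ℕ} (hW : W ∈ compLe m) {de : List ℕ × List ℕ}
    (h : de ∈ desh W) : de ∈ compPairs m := by
  have hs := mem_shuffleWord_of_mem_desh h
  rw [mem_compLe] at hW
  rw [mem_compPairs, ← sum_of_mem_shuffleWord _ _ hs]
  exact ⟨⟨fun a ha => hW.1 a ((mem_iff_of_mem_shuffleWord hs a).2 (Or.inl ha)),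
    fun a ha => hW.1 a ((mem_iff_of_mem_shuffleWord hs a).2 (Or.inr ha))⟩, hW.2⟩

/-- Shuffles of a pair in `compPairs m` lie in `compLe m`. [folklore] -/
theorem mem_compLe_of_mem_shuffleWord {m : ℕ} {p : List ℕ × List ℕ} (hp : p ∈ compPairs m)
    {W : List ℕ} (h : W ∈ shuffleWord p.1 p.2) : W ∈ compLe m := by
  rw [mem_compPairs] at hp
  rw [mem_compLe, sum_of_mem_shuffleWord _ _ h]
  refine ⟨fun a ha => ?_, hp.2⟩
  rcases (mem_iff_of_mem_shuffleWord h a).1 ha with h' | h'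
  · exact hp.1.1 a h'
  · exact hp.1.2 a h'

/-- **Deshuffle–shuffle resummation over generator words**: summing `Φ(U, V, W)` over words `W`
of weight `≤ m` and their deshuffles `(U, V)` is summing over pairs `(U, V)` of total weight `≤ m`
and the shuffles `W ∈ U ш V` (with multiplicities: `count_desh`). This is the duality between the
deconcatenation-free coproduct of `U(Lie G_𝒰)` and the shuffle product of `𝒰'`.
[cite: Brown2012, (2.20); Reutenauer1993, Ch. 1] -/
theorem sum_compLe_desh {M : Type*} [AddCommMonoid M] (m : ℕ) (Φ : List ℕ → List ℕ → List ℕ → M) :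
    ∑ W ∈ compLe m, ((desh W).map fun de => Φ de.1 de.2 W).sum =
      ∑ p ∈ compPairs m, ((shuffleWord p.1 p.2).map (Φ p.1 p.2)).sum := by
  have hL : ∀ W ∈ compLe m, ((desh W).map fun de => Φ de.1 de.2 W).sum =
      ∑ p ∈ compPairs m, (desh W : Multiset (List ℕ × List ℕ)).count p • Φ p.1 p.2 W := by
    intro W hW
    rw [list_map_sum_eq_sum_count]
    refine Finset.sum_subset (fun p hp => mem_compPairs_of_mem_desh hW (List.mem_toFinset.1 hp))
      fun p _ hp => ?_
    rw [Multiset.count_eq_zero.2 (fun h => hp (List.mem_toFinset.2 (Multiset.mem_coe.1 h))), zero_smul]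
  have hR : ∀ p ∈ compPairs m, ((shuffleWord p.1 p.2).map (Φ p.1 p.2)).sum =
      ∑ W ∈ compLe m, (shuffleWord p.1 p.2 : Multiset (List ℕ)).count W • Φ p.1 p.2 W := by
    intro p hp
    rw [list_map_sum_eq_sum_count]
    refine Finset.sum_subset (fun W hW => mem_compLe_of_mem_shuffleWord hp (List.mem_toFinset.1 hW))
      fun W _ hW => ?_
    rw [Multiset.count_eq_zero.2 (fun h => hW (List.mem_toFinset.2 (Multiset.mem_coe.1 h))), zero_smul]
  rw [Finset.sum_congr rfl hL, Finset.sum_congr rfl hR, Finset.sum_comm]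
  refine Finset.sum_congr rfl fun p _ => Finset.sum_congr rfl fun W _ => ?_
  rw [count_desh']

/-- **Deconcatenation reindexing over generator words**: summing `F(W_{≤k}, W_{>k})` over words
`W` of weight `≤ m` and cuts `k` is summing `F(U, V)` over pairs of total weight `≤ m`.
[cite: Brown2012, (2.20)] -/
theorem sum_compLe_cut {M : Type*} [AddCommMonoid M] (m : ℕ) (F : List ℕ → List ℕ → M) :
    ∑ W ∈ compLe m, ∑ k ∈ Finset.range (W.length + 1), F (W.take k) (W.drop k) =
      ∑ p ∈ compPairs m, F p.1 p.2 := by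
  rw [Finset.sum_sigma']
  refine Finset.sum_nbij' (fun x => (x.1.take x.2, x.1.drop x.2)) (fun p => ⟨p.1 ++ p.2, p.1.length⟩)
    ?_ ?_ ?_ ?_ ?_
  · rintro ⟨W, k⟩ hx
    simp only [Finset.mem_sigma, Finset.mem_range, mem_compLe] at hx
    rw [mem_compPairs]
    dsimp only
    rw [List.sum_take_add_sum_drop]
    exact ⟨⟨fun a ha => hx.1.1 a (List.mem_of_mem_take ha), fun a ha => hx.1.1 a (List.mem_of_mem_drop ha)⟩,
      hx.1.2⟩
  · rintro ⟨U, V⟩ hp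
    rw [mem_compPairs] at hp
    simp only [Finset.mem_sigma, Finset.mem_range, mem_compLe, List.mem_append, List.sum_append,
      List.length_append]
    refine ⟨⟨fun a ha => ?_, hp.2⟩, by omega⟩
    rcases ha with ha | ha
    · exact hp.1.1 a ha
    · exact hp.1.2 a ha
  · rintro ⟨W, k⟩ hx
    simp only [Finset.mem_sigma, Finset.mem_range] at hx
    have hk : (W.take k).length = k := by rw [List.length_take]; omega
    simp only [List.take_append_drop, hk]
  · rintro ⟨U, V⟩ -
    simp
  · rintro ⟨W, k⟩ -
    rfl

end Comp

/-! ## The orbit map of the unit path defined by a family of generators -/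

section Rho

variable (σ : ℕ → WordSeries Bool ℚ)

/-- **The orbit map `ρ_σ : 𝒪(₀Π₁) → 𝒰'` of the unit path** for the homomorphism
`G_𝒰 → (₀Π₁, ∘)` defined, by freeness of `Lie G_𝒰` ([Brown2012, §2.5]; [DG05, Prop. 2.3]), by
generators `σ_a ∈ ℚ⟨e₀, e₁⟩`: `ρ_σ(w) = Σ_W P_W(w) f_W`, where `P_W = s_{σ_{a₁}} ⋯ s_{σ_{a_k}}(1)`
is the action of the monomial `F_W` of `U(Lie G_𝒰)` on the unit path through the infinitesimal
Ihara action ([Brown2012, §2.1 (2.4), (2.6)]; [DG05, (5.11.5), (5.12.1)]).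
[cite: Brown2012, §2.1 (2.4), (2.6), §2.5; DeligneGoncharov2005, Prop. 2.3, Prop. 5.11, 5.12] -/
def ρgen (w : List Bool) : UAlg := ∑ W ∈ compLe w.length, (PW σ W w) • e 0 W

/-- Coefficients of `ρ_σ(w)`. [cite: Brown2012, §2.1 (2.6)] -/
theorem ρgen_apply (w : List Bool) (p : ℕ × List ℕ) :
    ρgen σ w p = if p.1 = 0 ∧ p.2 ∈ compLe w.length then PW σ p.2 w else 0 := by
  classical
  obtain ⟨m, W⟩ := p
  rw [ρgen, ShuffleMonoidAlgebra.finset_sum_apply]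
  simp_rw [ShuffleMonoidAlgebra.smul_apply, e_def, single_apply, Prod.mk.injEq, mul_ite, mul_one,
    mul_zero]
  by_cases hm : m = 0
  · subst hm
    simp only [true_and]
    exact Finset.sum_ite_eq' _ _ _
  · rw [if_neg fun h => hm h.1]
    exact Finset.sum_eq_zero fun W' _ => if_neg fun h => hm h.1.symm

/-- `ρ_σ(∅) = 1` (`P_∅ = 1`, and only `W = ∅` has weight `0`). [cite: Brown2012, §2.1 (2.6)] -/
theorem ρgen_nil : ρgen σ [] = 1 := by
  rw [ρgen, List.length_nil, compLe_zero, Finset.sum_singleton, PW_nil,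
    WordSeries.one_nil, one_smul, e_zero_nil]

variable {σ}

/-- **`ρ_σ` is graded into `𝒰'`**: `ρ_σ(w) ∈ 𝒰'_{|w|}` when `σ_a` is homogeneous of weight `a`
and vanishes unless `a` is odd `> 1`. [cite: Brown2012, §2.5 (2.20)–(2.21)] -/
theorem ρgen_mem (hwt : ∀ a, IsWt (σ a) a) (hodd : ∀ a, σ a ≠ 0 → Odd a ∧ 1 < a) (w : List Bool) :
    ρgen σ w ∈ uPrime w.length := by
  rw [mem_uPrime]
  intro p hp
  rw [ρgen_apply] at hp
  split_ifs at hp with h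
  · obtain ⟨h1, h2⟩ := h
    have hW : ∀ b ∈ p.2, Odd b ∧ 1 < b := fun b hb =>
      hodd b fun hb0 => hp (by rw [PW_eq_zero_of_mem hb0 hb]; rfl)
    refine ⟨⟨hW, ?_⟩, h1⟩
    rw [h1, mul_zero, zero_add]
    exact (isWt_PW hwt p.2 w hp).symm
  · exact absurd rfl hp

/-- A list sum of scalar multiples of a fixed vector. [folklore] -/
theorem list_sum_map_smul {ι N : Type*} [AddCommMonoid N] [Module ℚ N] (L : List ι) (f : ι → ℚ)
    (x : N) : (L.map fun i => f i • x).sum = (L.map f).sum • x := by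
  induction L with
  | nil => simp
  | cons i L ih => rw [List.map_cons, List.sum_cons, ih, List.map_cons, List.sum_cons, add_smul]

/-- **`ρ_σ` is a shuffle character** `𝒪(₀Π₁) → 𝒰'` for primitive homogeneous generators: the
transpose of `delta_PW` (`W ↦ P_W` is a coalgebra map from the deconcatenation-dual coproduct of
`U(Lie G_𝒰)` to the deshuffle coproduct), resummed by the deshuffle–shuffle duality.
[cite: Brown2012, §2.1 (2.6), §2.5 (2.20); DeligneGoncharov2005, Prop. 5.11] -/
theorem ρgen_mul (hwt : ∀ a, IsWt (σ a) a) (hprim : ∀ a, delta (σ a) = tensor (σ a) 1 + tensor 1 (σ a))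
    (u v : List Bool) : ρgen σ u * ρgen σ v = ((shuffleWord u v).map (ρgen σ)).sum := by
  classical
  set m := u.length + v.length with hm
  -- the right-hand side, resummed over pairs
  have hR : ((shuffleWord u v).map (ρgen σ)).sum =
      ∑ p ∈ compPairs m, (PW σ p.1 u * PW σ p.2 v) • (e 0 p.1 * e 0 p.2 : UAlg) := by
    have h1 : (shuffleWord u v).map (ρgen σ) =
        (shuffleWord u v).map fun w => ∑ W ∈ compLe m, (PW σ W w) • (e 0 W : UAlg) :=
      List.map_congr_left fun w hw => by rw [ρgen, length_of_mem_shuffleWord _ _ hw]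
    rw [h1, list_sum_map_finset_sum]
    have h2 : ∀ W ∈ compLe m, ((shuffleWord u v).map fun w => (PW σ W w) • (e 0 W : UAlg)).sum =
        ((desh W).map fun de => (PW σ de.1 u * PW σ de.2 v) • (e 0 W : UAlg)).sum := by
      intro W _
      rw [list_sum_map_smul, list_sum_map_smul, ← delta_apply, delta_PW hprim hwt W,
        WordSeries.list_sum_apply, List.map_map, WordSeries.list_sum_apply, List.map_map]
      rfl
    rw [Finset.sum_congr rfl h2, sum_compLe_desh m fun U V W => (PW σ U u * PW σ V v) • (e 0 W : UAlg)]
    refine Finset.sum_congr rfl fun p _ => ?_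
    rw [e_mul_e, List.smul_sum, List.map_map]
    rfl
  -- both sides as sums over the full rectangle
  have hF : ∀ p : List ℕ × List ℕ, (PW σ p.1 u * PW σ p.2 v) • (e 0 p.1 * e 0 p.2 : UAlg) ≠ 0 →
      p.1.sum = u.length ∧ p.2.sum = v.length := fun p hp => by
    have h := left_ne_zero_of_smul hp
    exact ⟨(isWt_PW hwt p.1 u (left_ne_zero_of_mul h)).symm,
      (isWt_PW hwt p.2 v (right_ne_zero_of_mul h)).symm⟩
  rw [hR, compPairs, Finset.sum_filter_of_ne fun p _ hp => by have := hF p hp; omega,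
    Finset.sum_product, ρgen, ρgen, Finset.sum_mul_sum]
  refine (Finset.sum_subset (compLe_mono (show u.length ≤ m by omega)) fun U hU hU' => ?_).trans
    (Finset.sum_congr rfl fun U _ => ?_)
  · refine Finset.sum_eq_zero fun V _ => ?_
    rw [smul_mul_smul_comm]
    refine smul_eq_zero_of_left (mul_eq_zero_of_left ?_ _) _
    by_contra h
    rw [mem_compLe] at hU hU'
    exact hU' ⟨hU.1, (isWt_PW hwt U u h).symm.le⟩
  · refine (Finset.sum_subset (compLe_mono (show v.length ≤ m by omega)) fun V hV hV' => ?_).trans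
      (Finset.sum_congr rfl fun V _ => smul_mul_smul_comm _ _ _ _)
    rw [smul_mul_smul_comm]
    refine smul_eq_zero_of_left (mul_eq_zero_of_right _ ?_) _
    by_contra h
    rw [mem_compLe] at hV hV'
    exact hV' ⟨hV.1, (isWt_PW hwt V v h).symm.le⟩

end Rho

/-! ## Pairing a point of `G_𝒰` with a family of polynomials -/

section Pair

variable {B : Type} [CommRing B] [Algebra ℚ B] (G : UAlg →+* B)
  (σ : ℕ → WordSeries Bool ℚ)

omit [Algebra ℚ B] in
/-- The characters of `𝒰'` through a point: `G(f_U) G(f_V) = Σ_{W ∈ U ш V} G(f_W)`.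
[cite: Brown2012, (2.20)] -/
theorem map_e_mul (U V : List ℕ) :
    G (e 0 U) * G (e 0 V) = ((shuffleWord U V).map fun W => G (e 0 W)).sum := by
  rw [← map_mul, e_mul_e, map_list_sum, List.map_map]
  rfl

/-- **The pairing of a `B`-point `G` of `G_𝒰` with a family of polynomials** `Φ_U ∈ ℚ⟨e₀,e₁⟩`
indexed by generator words: the `B`-series `v ↦ Σ_U Φ_U(v) G(f_U)` (a finite sum in each weight).
For `Φ = P` this is the orbit point `G ∘ ρ_σ = G·₀1₁` (`map_ρgen`). [cite: Brown2012, §2.1 (2.4),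
(2.6), (2.20)] -/
def pairG (Φ : List ℕ → WordSeries Bool ℚ) :
    WordSeries Bool B :=
  fun v => ∑ U ∈ compLe v.length, algebraMap ℚ B (Φ U v) * G (e 0 U)

/-- Coefficients of a pairing. [folklore] -/
theorem pairG_apply (Φ : List ℕ → WordSeries Bool ℚ) (v : List Bool) :
    pairG G Φ v = ∑ U ∈ compLe v.length, algebraMap ℚ B (Φ U v) * G (e 0 U) := rfl

/-- **The orbit point of `G` is the pairing with `P`**: `G(ρ_σ(v)) = Σ_U P_U(v) G(f_U)`.
[cite: Brown2012, §2.1 (2.4), (2.6)] -/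
theorem map_ρgen (v : List Bool) : G (ρgen σ v) = pairG G (PW σ) v := by
  rw [ρgen, map_sum, pairG_apply]
  refine Finset.sum_congr rfl fun U _ => ?_
  rw [map_rat_smul, Algebra.smul_def]

/-- A pairing may be computed over any larger set of generator words when the family is
homogeneous (`Φ_U` of weight `p + |U|`). [folklore] -/
theorem pairG_apply_of_le {Φ : List ℕ → WordSeries Bool ℚ} {p : ℕ}
    (hΦ : ∀ U v, Φ U v ≠ 0 → v.length = p + U.sum) {v : List Bool} {m : ℕ} (hm : v.length ≤ m) :
    pairG G Φ v = ∑ U ∈ compLe m, algebraMap ℚ B (Φ U v) * G (e 0 U) := by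
  rw [pairG_apply]
  refine Finset.sum_subset (compLe_mono hm) fun U hU hU' => ?_
  rw [show Φ U v = 0 from ?_, map_zero, zero_mul]
  by_contra h
  rw [mem_compLe] at hU hU'
  have := hΦ U v h
  exact hU' ⟨hU.1, by omega⟩

/-- **Pairings of deshuffle-convolved families multiply** (the point `G` is a character of the
shuffle algebra `𝒰'`): `⟨G, W ↦ Σ_{(U,V) ∈ desh W} Φ_U Ψ_V⟩ = ⟨G, Φ⟩ · ⟨G, Ψ⟩` for homogeneous
families. [cite: Brown2012, (2.20); Reutenauer1993, Ch. 1] -/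
theorem pairG_desh {Φ Ψ : List ℕ → WordSeries Bool ℚ} {p q : ℕ}
    (hΦ : ∀ U v, Φ U v ≠ 0 → v.length = p + U.sum) (hΨ : ∀ V v, Ψ V v ≠ 0 → v.length = q + V.sum) :
    pairG G (fun W => ((desh W).map fun de => Φ de.1 * Ψ de.2).sum) = pairG G Φ * pairG G Ψ := by
  refine WordSeries.ext fun w => ?_
  -- the summand of the common form
  set T : List ℕ × List ℕ → ℕ → B := fun pr k =>
    algebraMap ℚ B (Φ pr.1 (w.take k)) * algebraMap ℚ B (Ψ pr.2 (w.drop k)) *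
      (G (e 0 pr.1) * G (e 0 pr.2)) with hT
  have hT0 : ∀ (pr : List ℕ × List ℕ) (k : ℕ), k ∈ Finset.range (w.length + 1) → T pr k ≠ 0 →
      k = p + pr.1.sum ∧ w.length - k = q + pr.2.sum := by
    intro pr k hk h
    have h1 : Φ pr.1 (w.take k) ≠ 0 := fun h' => h (by simp only [hT, h', map_zero, zero_mul])
    have h2 : Ψ pr.2 (w.drop k) ≠ 0 := fun h' => h (by simp only [hT, h', map_zero, mul_zero, zero_mul])
    have e1 := hΦ _ _ h1
    have e2 := hΨ _ _ h2
    rw [List.length_take, min_eq_left (Nat.lt_succ_iff.1 (Finset.mem_range.1 hk))] at e1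
    rw [List.length_drop] at e2
    exact ⟨e1, e2⟩
  -- left-hand side
  have hL : pairG G (fun W => ((desh W).map fun de => Φ de.1 * Ψ de.2).sum) w =
      ∑ pr ∈ compLe w.length ×ˢ compLe w.length, ∑ k ∈ Finset.range (w.length + 1), T pr k := by
    rw [pairG_apply]
    have h1 : ∀ W ∈ compLe w.length,
        algebraMap ℚ B (((desh W).map fun de => Φ de.1 * Ψ de.2).sum w) * G (e 0 W) =
          ((desh W).map fun de => algebraMap ℚ B ((Φ de.1 * Ψ de.2) w) * G (e 0 W)).sum := by
      intro W _
      rw [WordSeries.list_sum_apply, List.map_map, map_list_sum, List.map_map, ← List.sum_map_mul_right]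
      rfl
    rw [Finset.sum_congr rfl h1,
      sum_compLe_desh w.length fun U V W => algebraMap ℚ B ((Φ U * Ψ V) w) * G (e 0 W)]
    have h2 : ∀ pr ∈ compPairs w.length,
        ((shuffleWord pr.1 pr.2).map fun W => algebraMap ℚ B ((Φ pr.1 * Ψ pr.2) w) * G (e 0 W)).sum =
          ∑ k ∈ Finset.range (w.length + 1), T pr k := by
      intro pr _
      rw [List.sum_map_mul_left, ← map_e_mul, WordSeries.mul_apply, map_sum, Finset.sum_mul]
      refine Finset.sum_congr rfl fun k _ => ?_
      simp only [hT, map_mul]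
    rw [Finset.sum_congr rfl h2, compPairs, Finset.sum_filter_of_ne]
    intro pr _ hpr
    obtain ⟨k, hk, hk'⟩ := Finset.exists_ne_zero_of_sum_ne_zero hpr
    have := hT0 pr k hk hk'
    have hk2 := Nat.lt_succ_iff.1 (Finset.mem_range.1 hk)
    omega
  -- right-hand side
  have hR : (pairG G Φ * pairG G Ψ) w =
      ∑ pr ∈ compLe w.length ×ˢ compLe w.length, ∑ k ∈ Finset.range (w.length + 1), T pr k := by
    rw [WordSeries.mul_apply, Finset.sum_comm]
    refine Finset.sum_congr rfl fun k hk => ?_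
    have hk2 := Nat.lt_succ_iff.1 (Finset.mem_range.1 hk)
    rw [pairG_apply_of_le G hΦ (show (w.take k).length ≤ w.length by rw [List.length_take]; omega),
      pairG_apply_of_le G hΨ (show (w.drop k).length ≤ w.length by rw [List.length_drop]; omega),
      Finset.sum_mul_sum, Finset.sum_product]
    refine Finset.sum_congr rfl fun U _ => Finset.sum_congr rfl fun V _ => ?_
    simp only [hT]
    ring
  rw [hL, hR]

/-- A pairing of a family multiplied on the right by a letter. [folklore] -/
theorem pairG_mul_X {Φ : List ℕ → WordSeries Bool ℚ} {p : ℕ}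
    (hΦ : ∀ U v, Φ U v ≠ 0 → v.length = p + U.sum) (t : Bool) :
    pairG G (fun W => Φ W * X t) = pairG G Φ * X t := by
  classical
  refine WordSeries.ext fun w => ?_
  rw [pairG_apply, WordSeries.mul_apply]
  have h1 : ∀ U ∈ compLe w.length, algebraMap ℚ B ((Φ U * X t : WordSeries Bool ℚ) w) * G (e 0 U) =
      ∑ k ∈ Finset.range (w.length + 1),
        algebraMap ℚ B (Φ U (w.take k)) * G (e 0 U) * (X t : WordSeries Bool B) (w.drop k) := by
    intro U _
    rw [WordSeries.mul_apply, map_sum, Finset.sum_mul]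
    refine Finset.sum_congr rfl fun k _ => ?_
    rw [map_mul, WordSeries.X_apply, WordSeries.X_apply]
    split_ifs <;> simp
  rw [Finset.sum_congr rfl h1, Finset.sum_comm]
  refine Finset.sum_congr rfl fun k hk => ?_
  have hk2 := Nat.lt_succ_iff.1 (Finset.mem_range.1 hk)
  rw [pairG_apply_of_le G hΦ (show (w.take k).length ≤ w.length by rw [List.length_take]; omega),
    Finset.sum_mul]

/-! ### The three pairings `𝒮(c)`, `𝒟(c)`, `A` and their algebra -/

/-- The homogeneity of `W ↦ s_W(X_c)`. [folklore] -/
theorem isWt_famS (hwt : ∀ a, IsWt (σ a) a) (c : List Bool) (U : List ℕ) (v : List Bool)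
    (h : SW σ U (wordX c) v ≠ 0) : v.length = c.length + U.sum :=
  (isWt_wordX c).SW hwt U v h

/-- The homogeneity of `W ↦ D_W(X_c)`. [folklore] -/
theorem isWt_famD (hwt : ∀ a, IsWt (σ a) a) (c : List Bool) (U : List ℕ) (v : List Bool)
    (h : DW σ U (wordX c) v ≠ 0) : v.length = c.length + U.sum :=
  (isWt_wordX c).DW hwt U v h

/-- The homogeneity of `W ↦ P_W`. [folklore] -/
theorem isWt_famP (hwt : ∀ a, IsWt (σ a) a) (U : List ℕ) (v : List Bool) (h : PW σ U v ≠ 0) :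
    v.length = 0 + U.sum := by
  rw [zero_add]; exact isWt_PW hwt U v h

variable {σ}

/-- **`𝒮(c) = 𝒟(c) · A`**: `Σ_W G(f_W) s_W(X_c) = (Σ_W G(f_W) D_W(X_c)) · (Σ_W G(f_W) P_W)` — the
exponential of the twisted Leibniz rule `s_W(x·1) = Σ_{desh} D_U(x) s_V(1)` against the character
`G`. [cite: DeligneGoncharov2005, (5.11.5); Brown2012, (2.20)] -/
theorem pairS_eq_pairD_mul (hwt : ∀ a, IsWt (σ a) a) (c : List Bool) :
    pairG G (fun W => SW σ W (wordX c)) = pairG G (fun W => DW σ W (wordX c)) * pairG G (PW σ) := by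
  have h : (fun W => SW σ W (wordX c)) =
      fun W => ((desh W).map fun de => DW σ de.1 (wordX c) * PW σ de.2).sum := by
    funext W
    show SW σ W (wordX c) = ((desh W).map fun de => DW σ de.1 (wordX c) * SW σ de.2 1).sum
    rw [← SW_mul, mul_one]
  rw [h]
  exact pairG_desh G (Φ := fun W => DW σ W (wordX c)) (Ψ := PW σ) (isWt_famD σ hwt c) (isWt_famP σ hwt)

/-- **`𝒟` is multiplicative**: `𝒟(c d) = 𝒟(c) 𝒟(d)` — the exponential of the iterated Leibniz
rule of the derivations `D_W`. [cite: DeligneGoncharov2005, (5.11.4)] -/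
theorem pairD_append (hwt : ∀ a, IsWt (σ a) a) (c d : List Bool) :
    pairG G (fun W => DW σ W (wordX (c ++ d))) =
      pairG G (fun W => DW σ W (wordX c)) * pairG G (fun W => DW σ W (wordX d)) := by
  have h : (fun W => DW σ W (wordX (c ++ d))) =
      fun W => ((desh W).map fun de => DW σ de.1 (wordX c) * DW σ de.2 (wordX d)).sum := by
    funext W
    rw [wordX_append, DW_mul]
  rw [h]
  exact pairG_desh G (Φ := fun W => DW σ W (wordX c)) (Ψ := fun W => DW σ W (wordX d))
    (isWt_famD σ hwt c) (isWt_famD σ hwt d)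

/-- The cast of a `0/1`-valued coefficient. [folklore] -/
theorem algebraMap_ite (P : Prop) [Decidable P] :
    algebraMap ℚ B (if P then 1 else 0) = if P then 1 else 0 := by
  split_ifs <;> simp

variable (σ)

/-- **`𝒟(∅) = 1`** (`D_W(1) = 0` for `W ≠ ∅`). [folklore] -/
theorem pairD_nil : pairG G (fun W => DW σ W (wordX [])) = 1 := by
  refine WordSeries.ext fun v => ?_
  rw [pairG_apply, Finset.sum_eq_single_of_mem [] (nil_mem_compLe _) fun U _ hU => by
    simp only [wordX_nil, DW_one_of_ne_nil σ hU, WordSeries.zero_apply, map_zero, zero_mul]]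
  simp only [wordX_nil, GoncharovFormalIteratedIntegrals.DW_nil, e_zero_nil, map_one, mul_one]
  cases v <;> simp

/-- **`𝒟(e₀) = e₀`** (`D_W(e₀) = 0` for `W ≠ ∅`: Ihara's derivations kill `e₀`).
[cite: DeligneGoncharov2005, (5.11.1)] -/
theorem pairD_false : pairG G (fun W => DW σ W (wordX [false])) = X false := by
  refine WordSeries.ext fun v => ?_
  have hw : (wordX [false] : WordSeries Bool ℚ) = X false := by
    rw [wordX_cons, wordX_nil, mul_one]
  rw [pairG_apply, Finset.sum_eq_single_of_mem [] (nil_mem_compLe _) fun U _ hU => by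
    simp only [hw, DW_X_false_of_ne_nil σ hU, WordSeries.zero_apply, map_zero, zero_mul]]
  simp only [hw, GoncharovFormalIteratedIntegrals.DW_nil, e_zero_nil, map_one, mul_one,
    WordSeries.X_apply, algebraMap_ite]

/-- **`𝒮(e₁) = A e₁`** (`s_W(e₁) = P_W e₁`). [folklore] -/
theorem pairS_true (hwt : ∀ a, IsWt (σ a) a) :
    pairG G (fun W => SW σ W (wordX [true])) = pairG G (PW σ) * X true := by
  have h : (fun W => SW σ W (wordX [true])) = fun W => PW σ W * X true := by
    funext W
    rw [wordX_cons, wordX_nil, mul_one, SW_X_true]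
  rw [h]
  exact pairG_mul_X G (isWt_famP σ hwt) true

/-- `A(∅) = 1` for the orbit point `A = G ∘ ρ_σ`. [cite: Brown2012, §2.1 (2.6)] -/
theorem pairP_nil : pairG G (PW σ) [] = 1 := by
  rw [pairG_apply, List.length_nil, compLe_zero, Finset.sum_singleton, PW_nil,
    WordSeries.one_nil, map_one, e_zero_nil, map_one, mul_one]

variable {σ}

/-- The orbit point `A = G ∘ ρ_σ` is a shuffle character (a point of `₀Π₁`).
[cite: Brown2012, §2.1 (2.4), (2.6)] -/
theorem pairP_mul (hwt : ∀ a, IsWt (σ a) a) (hprim : ∀ a, delta (σ a) = tensor (σ a) 1 + tensor 1 (σ a))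
    (u v : List Bool) :
    pairG G (PW σ) u * pairG G (PW σ) v = ((shuffleWord u v).map (pairG G (PW σ))).sum := by
  have h : pairG G (PW σ) = fun w => G (ρgen σ w) := funext fun w => (map_ρgen G σ w).symm
  rw [h]
  dsimp only
  rw [← map_mul, ρgen_mul hwt hprim, map_list_sum, List.map_map]
  rfl

/-- **`𝒟(e₁) = A e₁ A⁻¹`**: from `𝒮(e₁) = 𝒟(e₁) A` and `𝒮(e₁) = A e₁`.
[cite: DeligneGoncharov2005, (5.11.2), (5.11.4)] -/
theorem pairD_true (hwt : ∀ a, IsWt (σ a) a) (hprim : ∀ a, delta (σ a) = tensor (σ a) 1 + tensor 1 (σ a)) :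
    pairG G (fun W => DW σ W (wordX [true])) =
      pairG G (PW σ) * X true * phiK (Im (pairG G (PW σ))) true false := by
  have h1 := pairS_eq_pairD_mul G hwt [true]
  rw [pairS_true G σ hwt] at h1
  have hinv := phiK_Im_mul_inv (pairG G (PW σ)) (pairP_nil G σ) (pairP_mul G hwt hprim)
  rw [phiK_Im_false_true] at hinv
  calc pairG G (fun W => DW σ W (wordX [true]))
      = pairG G (fun W => DW σ W (wordX [true])) * (pairG G (PW σ) * phiK (Im (pairG G (PW σ))) true false) := by
        rw [hinv, mul_one]
    _ = pairG G (PW σ) * X true * phiK (Im (pairG G (PW σ))) true false := by rw [← mul_assoc, ← h1]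

/-- **`𝒟(c) = ⟨A⟩(X_c)`**: the exponential of the derivations of the point `G` is Ihara's
substitution `e₀ ↦ e₀, e₁ ↦ A e₁ A⁻¹` of its orbit point `A = G ∘ ρ_σ`.
[cite: DeligneGoncharov2005, (5.11.4); Brown2012, §2.1 (2.4)] -/
theorem pairD_eq_iharaWord (hwt : ∀ a, IsWt (σ a) a)
    (hprim : ∀ a, delta (σ a) = tensor (σ a) 1 + tensor 1 (σ a)) :
    ∀ c : List Bool, pairG G (fun W => DW σ W (wordX c)) = iharaWord (Im (pairG G (PW σ))) c
  | [] => by rw [pairD_nil, iharaWord, conjWord_nil]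
  | k :: c => by
    rw [iharaWord, conjWord_cons, ← iharaWord,
      show (fun W => DW σ W (wordX (k :: c))) = fun W => DW σ W (wordX ([k] ++ c)) from rfl,
      pairD_append G hwt, pairD_eq_iharaWord hwt hprim c]
    cases k with
    | false =>
      rw [pairD_false, phiK_Im_self _ (pairP_nil G σ)]
      simp only [one_mul]
    | true =>
      rw [pairD_true G hwt hprim, phiK_Im_false_true]
      simp only [mul_assoc]

/-- **The key identity: `𝒮(c) = ⟨A⟩(X_c) · A`.** For every `B`-point `G` of the free group `G_𝒰`
and every word `c`, `Σ_W G(f_W) s_W(X_c) = ⟨a⟩(X_c)·a` with `a = G ∘ ρ_σ`: the exponentiated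
infinitesimal action of `G` is Ihara's action `x ↦ ⟨a⟩(x)·a` of its orbit point
([DG05, (5.11.5)]: `⟨a⟩_{1,0} : g ↦ a·⟨a⟩₀(g)`, in Brown's orientation).
[cite: DeligneGoncharov2005, Prop. 5.11 (5.11.5), 5.12 (5.12.1); Brown2012, §2.1 (2.4)–(2.6)] -/
theorem pairS_eq_iharaWord_mul (hwt : ∀ a, IsWt (σ a) a)
    (hprim : ∀ a, delta (σ a) = tensor (σ a) 1 + tensor 1 (σ a)) (c : List Bool) :
    pairG G (fun W => SW σ W (wordX c)) = iharaWord (Im (pairG G (PW σ))) c * pairG G (PW σ) := by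
  rw [pairS_eq_pairD_mul G hwt, pairD_eq_iharaWord G hwt hprim]

end Pair

/-! ## The orbit map is a homomorphism for Ihara's law, at all points -/

section PointHom

variable {σ : ℕ → WordSeries Bool ℚ}

/-- **Homomorphy of the orbit map at all points.** For primitive homogeneous generators `σ`, every
commutative `ℚ`-algebra `B` and all `B`-points `g, h` of `G_𝒰 = Spec 𝒰'`:
`(g*h) ∘ ρ_σ = (g ∘ ρ_σ) ⋆ (h ∘ ρ_σ)` — the orbit map `G_𝒰 → (₀Π₁, ∘)` defined by the free
generators is a homomorphism of group functors ([DG05, (5.10.3), Prop. 5.11, 5.12, (5.15.1)];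
[Brown2012, §2.1 (2.3)–(2.6), §2.5]).
[cite: DeligneGoncharov2005, (5.10.3), Prop. 5.11, (5.12.1), (5.15.1); Brown2012, §2.1 (2.4)–(2.6),
§2.5, (2.20)] -/
theorem ρgen_pointHom (hwt : ∀ a, IsWt (σ a) a)
    (hprim : ∀ a, delta (σ a) = tensor (σ a) 1 + tensor 1 (σ a))
    {B : Type} [CommRing B] [Algebra ℚ B] (G H : UAlg →+* B) (w : List Bool) :
    pointMul G H (ρgen σ w) = iharaLaw (fun v => G (ρgen σ v)) (fun v => H (ρgen σ v)) w := by
  have hG : (fun v => G (ρgen σ v)) = pairG G (PW σ) := funext (map_ρgen G σ)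
  have hH : (fun v => H (ρgen σ v)) = pairG H (PW σ) := funext (map_ρgen H σ)
  set T : List Bool → List ℕ × List ℕ → B := fun c pr =>
    algebraMap ℚ B (PW σ pr.2 c) * algebraMap ℚ B (SW σ pr.1 (wordX c) w) *
      (H (e 0 pr.2) * G (e 0 pr.1)) with hT
  -- right-hand side
  have hR : iharaLaw (pairG G (PW σ)) (pairG H (PW σ)) w =
      ∑ c ∈ GoncharovFormalIteratedIntegrals.subwords w,
        ∑ pr ∈ compLe w.length ×ˢ compLe w.length, T c pr := by
    have hΘ : ∀ c w', iharaWord (Im (pairG G (PW σ))) c w' ≠ 0 → List.Sublist c w' :=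
      conjWord_apply_ne_zero _ false
    rw [iharaLaw, iharaMul, phiK_Im_false_true, ← contr_mul_const _ _ hΘ]
    have h1 : (fun d => iharaWord (Im (pairG G (PW σ))) d * pairG G (PW σ)) =
        fun d => pairG G (fun W => SW σ W (wordX d)) :=
      funext fun d => (pairS_eq_iharaWord_mul G hwt hprim d).symm
    rw [h1, contr_apply]
    refine Finset.sum_congr rfl fun c hc => ?_
    have hcm : c.length ≤ w.length := (GoncharovFormalIteratedIntegrals.mem_subwords.1 hc).length_le
    rw [pairG_apply_of_le H (isWt_famP σ hwt) hcm, pairG_apply, Finset.sum_mul_sum,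
      Finset.sum_product_right]
    refine Finset.sum_congr rfl fun V _ => Finset.sum_congr rfl fun U _ => ?_
    simp only [hT]
    ring
  -- left-hand side
  have hL : pointMul G H (ρgen σ w) =
      ∑ c ∈ GoncharovFormalIteratedIntegrals.subwords w,
        ∑ pr ∈ compLe w.length ×ˢ compLe w.length, T c pr := by
    rw [ρgen, map_sum]
    have h1 : ∀ W ∈ compLe w.length, pointMul G H (PW σ W w • e 0 W) =
        ∑ k ∈ Finset.range (W.length + 1), ∑ c ∈ GoncharovFormalIteratedIntegrals.subwords w,
          T c (W.take k, W.drop k) := by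
      intro W _
      rw [map_rat_smul, Algebra.smul_def, e_def, pointMul_single, Finset.mul_sum]
      refine Finset.sum_congr rfl fun k _ => ?_
      dsimp only
      rw [← e_def, show PW σ W w = SW σ (W.take k) (PW σ (W.drop k)) w by
          rw [PW, PW, ← SW_append, List.take_append_drop],
        isLocal_SW σ (W.take k) (PW σ (W.drop k)) w, map_sum, Finset.sum_mul]
      refine Finset.sum_congr rfl fun c _ => ?_
      simp only [hT, map_mul]
    rw [Finset.sum_congr rfl h1,
      sum_compLe_cut w.length fun U V => ∑ c ∈ GoncharovFormalIteratedIntegrals.subwords w, T c (U, V),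
      Finset.sum_comm, compPairs]
    refine Finset.sum_congr rfl fun c _ => Finset.sum_filter_of_ne fun pr _ hpr => ?_
    have h2 : PW σ pr.2 c ≠ 0 := fun h' => hpr (by simp only [hT, h', map_zero, zero_mul])
    have h3 : SW σ pr.1 (wordX c) w ≠ 0 := fun h' =>
      hpr (by simp only [hT, h', map_zero, mul_zero, zero_mul])
    have e2 := isWt_PW hwt pr.2 c h2
    have e3 := isWt_famS σ hwt c pr.1 w h3
    omega
  rw [hG, hH, hL, hR]

/-- **Brown's motivic package from free Lie generators and the comparison at a point.**  Let
`σ_n ∈ ℚ⟨e₀, e₁⟩` (`n ≥ 3` odd; `σ_n` homogeneous of weight `n`, zero for other `n`) be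
PRIMITIVE — i.e. Lie — polynomials: the images of free generators of `Lie G_𝒰`
([Brown2012, §2.5]: "`Lie G_𝒰` is isomorphic to the free Lie algebra with one generator `σ_{2i+1}`
in every degree `-2i-1`"; [DG05, Prop. 2.3], by Borel's ranks of `K_{2n-1}(ℤ) ⊗ ℚ`), acting on
`₀Π₁` by the infinitesimal Ihara action ([DG05, 5.8–5.12]).  By freeness they define the orbit
map `ρ_σ : 𝒪(₀Π₁) → 𝒰'` of the unit path (`ρgen σ`), which this file proves to be a graded
shuffle character whose orbit map is a homomorphism for Ihara's law at all points
(`ρgen_mul`, `ρgen_mem`, `ρgen_pointHom`).  Hence, by `motivicMZV_nonempty_of_pointOrbit`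
(`BrownMotivicOrbitPoint.lean`): if moreover there are an even rational point `γ ∈ ₀Π₁(ℚ)` and a
real point `(a, t₀)` of `G_𝒰 × 𝔸¹` with **`dch = (a ∘ ρ_σ) ⋆ τ(√t₀).γ`** ([Brown2012, §2.3
(2.12)]: `G'_𝒰 × 𝔸¹ ≅ 𝒵 ∋ dch`, `(g, t) ↦ g τ(√t).γ`; [DG05, 5.19–5.20, Thm. 5.24]), then Brown's
package `MotivicMZV` exists.  The residual Deligne–Goncharov input is thus first-order data: Lie
polynomials `σ_{2i+1}`, a rational even `γ`, a real point `(a, t₀)`, and one identity of real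
series.
[cite: Brown2012, §2.1 (2.3)–(2.6), §2.3 (2.12), §2.5 (2.20)–(2.22); DeligneGoncharov2005,
Prop. 2.3, (5.10.3), Prop. 5.11, 5.12, (5.15.1), 5.16, 5.19–5.20, Thm. 5.24] -/
theorem motivicMZV_nonempty_of_lieGenerators (σ : ℕ → WordSeries Bool ℚ)
    (σ_wt : ∀ (n : ℕ) (w : List Bool), σ n w ≠ 0 → w.length = n ∧ Odd n ∧ 1 < n)
    (σ_prim : ∀ n, delta (σ n) = tensor (σ n) 1 + tensor 1 (σ n))
    (γ : List Bool → ℚ) (γ_nil : γ [] = 1)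
    (γ_mul : ∀ u v : List Bool, γ u * γ v = ((shuffleWord u v).map γ).sum)
    (γ_odd : ∀ w : List Bool, Odd w.length → γ w = 0) (a : UAlg →+* ℝ) (t₀ : ℝ)
    (orbit : ∀ w : List Bool,
      dch w = iharaLaw (fun v => a (ρgen σ v)) (fun v => (γ v : ℝ) * t₀ ^ (v.length / 2)) w) :
    motivicMZV_nonempty := by
  have hwt : ∀ n, IsWt (σ n) n := fun n w h => (σ_wt n w h).1
  have hodd : ∀ n, σ n ≠ 0 → Odd n ∧ 1 < n := fun n h => by
    obtain ⟨w, hw⟩ := Function.ne_iff.1 h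
    exact (σ_wt n w hw).2
  exact motivicMZV_nonempty_of_pointOrbit (ρgen σ) (ρgen_nil σ) (ρgen_mul hwt σ_prim) (ρgen_mem hwt hodd)
    (fun B _ _ g h w => ρgen_pointHom hwt σ_prim g h w) γ γ_nil γ_mul γ_odd a t₀ orbit

end PointHom

end Brown2012

end Literature.NumberTheory.Transcendental
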